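import Mathlib
import HarnessLib
import Summits.ValiantsHypothesis.ValiantsHypothesis.Theorems.LacunarySymmetroidMatrixDescartesOsculationLawPeelMaximalBranchTwoSided

/-!
# ValiantsHypothesis / LacunarySymmetroid — crux `MatrixDescartes` (stmt-ValiantsHypothesis-18050, V1),
# line `Cruxes/MatrixDescartes/Lines/osculation_law.lean` («osculation-law»), stub `stub_peel` (ALL ranks):
# THE COMPONENT OF A CURVE POINT, TWO-SIDED, IN HORIZON FORM (piece (γ1) of NOTE-p7g12-peel-general-r-sizing.md §6)

Rank-free repackaging of val-lit-p7 g12's two-sided maximal branch (`exists_maximal_branch`, p625258) as ONE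
continuous positive solution `β` of `Φ = 0` on an open interval `(α, ω) ∋ t₀` through the curve point `(t₀, b₀)` of
the open quadrant, truncated at a HORIZON `B > t₀` on the right (the currency of the component count):
* `continuousOn_of_pieces` — continuity on `(α, T)` from the two one-sided pieces and continuity at `t₀`;
* **`exists_component`** — `0 ≤ α < t₀ < ω ≤ B`, `β t₀ = b₀`, `β` continuous positive solution on `(α, ω)`, with a
  RIGHT END of one of three kinds — ALIVE at the horizon (`ω = B`, `β` continuous positive solution on `(α, B]`),
  ZERO (`β → 0` as `t → ω⁻`), ESCAPE (`β → +∞`) — and a LEFT END of one of three kinds — REACHES `0⁺` (`α = 0`),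
  ZERO (`β → 0` as `t → α⁺`), ESCAPE (`β → +∞`).
The component count of the general-`r` peel runs over these packages (uniqueness = `…PeelComponentUnique`, ends =
`…PeelEndCharges`).  Honest framing: a rank-free LEMMA toward the OPEN stub `stub_peel` (all `r`); nothing of the
summit is proved; `MatrixDescartes`, the LAW and `VP ≠ VNP` are NOT proved.  No definitions, no named facts.
(val-lit-p4 g13, helper `--supports stmt-ValiantsHypothesis-18050`; lane of val-lit-p7 g12.)
-/

-- `Summit.ValiantsHypothesis.ValiantsHypothesis.…` is the tree's mandated single-conjunct layout (Sub = Summit).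
set_option linter.dupNamespace false

noncomputable section

namespace Summit.ValiantsHypothesis.ValiantsHypothesis.Theorems.LacunarySymmetroidMatrixDescartes

open Polynomial Set Filter
open MvPolynomial (pderiv)
open scoped BigOperators Topology

namespace OsculationPeel

/-- **Continuity from the pieces**: continuity at `t₀` together with continuity on `(α, t₀]` and on `[t₀, T)`
gives continuity on `(α, T)`. [folklore] -/
theorem continuousOn_of_pieces {β : ℝ → ℝ} {α t₀ T : ℝ} (hca : ContinuousAt β t₀)
    (hL : ContinuousOn β (Ioc α t₀)) (hR : ContinuousOn β (Ico t₀ T)) : ContinuousOn β (Ioo α T) := by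
  intro u hu
  rcases lt_trichotomy u t₀ with h | h | h
  · exact ((hL u ⟨hu.1, h.le⟩).continuousAt
      (mem_of_superset (Ioo_mem_nhds hu.1 h) Ioo_subset_Ioc_self)).continuousWithinAt
  · rw [h]; exact hca.continuousWithinAt
  · exact ((hR u ⟨h.le, hu.2⟩).continuousAt
      (mem_of_superset (Ioo_mem_nhds h hu.2) Ioo_subset_Ico_self)).continuousWithinAt

section

variable (Φ : MvPolynomial (Fin 2) ℝ) (P : ℝ → ℝ[X])
    (hP : ∀ t b, (P t).eval b = MvPolynomial.eval ![t, b] Φ) (hsplit : ∀ t, 0 < t → (P t).Splits)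
    (hfin : {p : Fin 2 → ℝ | 0 < p 0 ∧ 0 < p 1 ∧ MvPolynomial.eval p Φ = 0 ∧
      MvPolynomial.eval p
        (MvPolynomial.X 0 * MvPolynomial.pderiv 0 (MvPolynomial.X 0 * MvPolynomial.pderiv 0 Φ)
            * (MvPolynomial.X 1 * MvPolynomial.pderiv 1 Φ) ^ 2
          - 2 * (MvPolynomial.X 0 * MvPolynomial.pderiv 0 (MvPolynomial.X 1 * MvPolynomial.pderiv 1 Φ))
            * (MvPolynomial.X 0 * MvPolynomial.pderiv 0 Φ) * (MvPolynomial.X 1 * MvPolynomial.pderiv 1 Φ)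
          + MvPolynomial.X 1 * MvPolynomial.pderiv 1 (MvPolynomial.X 1 * MvPolynomial.pderiv 1 Φ)
            * (MvPolynomial.X 0 * MvPolynomial.pderiv 0 Φ) ^ 2) = 0}.Finite)
    (hgp : ∀ p ∈ {p : Fin 2 → ℝ | 0 < p 0 ∧ 0 < p 1 ∧ MvPolynomial.eval p Φ = 0 ∧
      MvPolynomial.eval p
        (MvPolynomial.X 0 * MvPolynomial.pderiv 0 (MvPolynomial.X 0 * MvPolynomial.pderiv 0 Φ)
            * (MvPolynomial.X 1 * MvPolynomial.pderiv 1 Φ) ^ 2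
          - 2 * (MvPolynomial.X 0 * MvPolynomial.pderiv 0 (MvPolynomial.X 1 * MvPolynomial.pderiv 1 Φ))
            * (MvPolynomial.X 0 * MvPolynomial.pderiv 0 Φ) * (MvPolynomial.X 1 * MvPolynomial.pderiv 1 Φ)
          + MvPolynomial.X 1 * MvPolynomial.pderiv 1 (MvPolynomial.X 1 * MvPolynomial.pderiv 1 Φ)
            * (MvPolynomial.X 0 * MvPolynomial.pderiv 0 Φ) ^ 2) = 0},
        MvPolynomial.eval p (MvPolynomial.pderiv 1 Φ) ≠ 0)

include hP hsplit hfin hgp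

/-- **The component of a curve point, two-sided, in horizon form** (piece (γ1)).  Through a curve point
`(t₀, b₀)` of the open quadrant with `t₀ < B` passes a continuous positive solution `β` of `Φ = 0` on an open interval
`(α, ω)`, `0 ≤ α < t₀ < ω ≤ B`, whose RIGHT END is ALIVE at the horizon (`ω = B` and `β` is a continuous positive
solution on `(α, B]`), ZERO (`β → 0` at `ω⁻`) or ESCAPE (`β → +∞` at `ω⁻`), and whose LEFT END reaches `0⁺` (`α = 0`),
is ZERO (`β → 0` at `α⁺`) or is ESCAPE (`β → +∞` at `α⁺`). [folklore; `exists_maximal_branch` truncated at `B`] -/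
theorem exists_component {t₀ b₀ B : ℝ} (ht₀ : 0 < t₀) (hb₀ : 0 < b₀) (hB : t₀ < B)
    (hΦ : MvPolynomial.eval ![t₀, b₀] Φ = 0) :
    ∃ (β : ℝ → ℝ) (α ω : ℝ), 0 ≤ α ∧ α < t₀ ∧ t₀ < ω ∧ ω ≤ B ∧ β t₀ = b₀ ∧
      ContinuousOn β (Ioo α ω) ∧ (∀ t ∈ Ioo α ω, 0 < β t ∧ MvPolynomial.eval ![t, β t] Φ = 0) ∧
      ((ω = B ∧ ContinuousOn β (Ioc α B) ∧ ∀ t ∈ Ioc α B, 0 < β t ∧ MvPolynomial.eval ![t, β t] Φ = 0) ∨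
        Tendsto β (𝓝[<] ω) (𝓝 0) ∨ Tendsto β (𝓝[<] ω) atTop) ∧
      (α = 0 ∨ Tendsto β (𝓝[>] α) (𝓝 0) ∨ Tendsto β (𝓝[>] α) atTop) := by
  obtain ⟨β, hβ0, hca, hL, hR⟩ := exists_maximal_branch Φ P hP hsplit hfin hgp ht₀ hb₀ hΦ
  -- RIGHT data in horizon form: `ω ∈ (t₀, B]`, the piece `[t₀, ω)` inside a longer piece `[t₀, T)` when alive
  have hRdata : ∃ ω T, t₀ < ω ∧ ω ≤ B ∧ ω ≤ T ∧ ContinuousOn β (Ico t₀ T) ∧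
      (∀ t ∈ Ico t₀ T, 0 < β t ∧ MvPolynomial.eval ![t, β t] Φ = 0) ∧
      ((ω = B ∧ B < T) ∨ Tendsto β (𝓝[<] ω) (𝓝 0) ∨ Tendsto β (𝓝[<] ω) atTop) := by
    rcases hR with hfe | ⟨ω, hω, hcont, hsol, hend⟩
    · obtain ⟨hcont, hsol⟩ := hfe (B + 1) (by linarith)
      exact ⟨B, B + 1, hB, le_rfl, by linarith, hcont, hsol, Or.inl ⟨rfl, by linarith⟩⟩
    · by_cases hωB : ω ≤ B
      · exact ⟨ω, ω, hω, hωB, le_rfl, hcont, hsol, Or.inr hend⟩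
      · exact ⟨B, ω, hB, le_rfl, (not_le.1 hωB).le, hcont, hsol, Or.inl ⟨rfl, not_le.1 hωB⟩⟩
  -- LEFT data in horizon form
  have hLdata : ∃ α, 0 ≤ α ∧ α < t₀ ∧ ContinuousOn β (Ioc α t₀) ∧
      (∀ t ∈ Ioc α t₀, 0 < β t ∧ MvPolynomial.eval ![t, β t] Φ = 0) ∧
      (α = 0 ∨ Tendsto β (𝓝[>] α) (𝓝 0) ∨ Tendsto β (𝓝[>] α) atTop) := by
    rcases hL with hfe | ⟨α, hα, hαt, hcont, hsol, hend⟩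
    · refine ⟨0, le_rfl, ht₀, ?_, ?_, Or.inl rfl⟩
      · intro u hu
        have hu2 : 0 < u / 2 := by linarith [hu.1]
        have hu2' : u / 2 < t₀ := by linarith [hu.1, hu.2]
        have hcw : ContinuousWithinAt β (Ioc (u / 2) t₀) u :=
          (hfe (u / 2) hu2 hu2').1 u ⟨by linarith [hu.1], hu.2⟩
        refine hcw.mono_of_mem_nhdsWithin ?_
        refine mem_nhdsWithin.2 ⟨Ioi (u / 2), isOpen_Ioi, by show u / 2 < u; linarith [hu.1], ?_⟩
        rintro x ⟨hx1, hx2⟩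
        exact ⟨hx1, hx2.2⟩
      · intro t ht
        exact (hfe (t / 2) (by linarith [ht.1]) (by linarith [ht.1, ht.2])).2 t ⟨by linarith [ht.1], ht.2⟩
    · exact ⟨α, hα.le, hαt, hcont, hsol, Or.inr hend⟩
  obtain ⟨ω, T, hω, hωB, hωT, hRc, hRs, hRk⟩ := hRdata
  obtain ⟨α, hα0, hαt, hLc, hLs, hLk⟩ := hLdata
  have hcT : ContinuousOn β (Ioo α T) := continuousOn_of_pieces hca hLc hRc
  have hsT : ∀ t ∈ Ioo α T, 0 < β t ∧ MvPolynomial.eval ![t, β t] Φ = 0 := by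
    intro t ht
    by_cases h : t ≤ t₀
    · exact hLs t ⟨ht.1, h⟩
    · exact hRs t ⟨(not_le.1 h).le, ht.2⟩
  refine ⟨β, α, ω, hα0, hαt, hω, hωB, hβ0, hcT.mono (Ioo_subset_Ioo_right hωT),
    fun t ht => hsT t ⟨ht.1, lt_of_lt_of_le ht.2 hωT⟩, ?_, hLk⟩
  rcases hRk with ⟨hωB', hBT⟩ | hend
  · refine Or.inl ⟨hωB', hcT.mono fun t ht => ⟨ht.1, lt_of_le_of_lt ht.2 hBT⟩,
      fun t ht => hsT t ⟨ht.1, lt_of_le_of_lt ht.2 hBT⟩⟩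
  · exact Or.inr hend

end

end OsculationPeel

end Summit.ValiantsHypothesis.ValiantsHypothesis.Theorems.LacunarySymmetroidMatrixDescartes

end
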